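import Mathlib
import HarnessLib
import Summits.NavierStokesRegularity.NavierStokesRegularity.Theorems.TypeIQuarterGateScarEnvelopeTypeIForcedTsaiSemantics

/-!
# ARM B lane E-exact — stub S4 DISCHARGED: the `ℝ³` Gaussian-moment identity behind `pairVec`
# (crux `ScarEnvelopeTypeI` = stmt-NavierStokesRegularity-23843; cell ns-wall-extremal, PREREG-WALL-1 A1 §B2(d) lane E-exact;
#  cert hand ns-crc-p2 g4's soundness skeleton `ForcedTsaiSound_skeleton_v2.lean`, stub `stub_moment_pairVec`)

The kernel checker `…ForcedTsaiCert` evaluates Gaussian moments of sparse rational polynomials EXACTLY through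
`mom1`/`mom3`/`pairPoly`/`pairVec` (all in `ℚ`).  This file proves that these rational numbers ARE the moments:

* `integral_pow_mul_gauss1` — `∫_ℝ xⁿ e^{−bx²} dx = mom1 n b · √(π/b)` for rational `b > 0` (`mom1_cast`: the checker's `foldl`
  IS `0` for odd `n` and `∏_{i<n/2}(2i+1)/(2b)` for even `n`), with integrability;
* `integral_mono_gauss` — Fubini on `EuclideanSpace ℝ (Fin 3)` (volume-preserving `toLp`) ⇒ monomial moments
  `= c · mom3 e₁ e₂ e₃ b · (π/b)^{3/2}`;
* `integral_qpoly_gauss`, `pairPoly_eq_sum_mul` — linearity over the monomial lists and the `foldl` bookkeeping of `pairPoly`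
  (no new definitions: every moment is the checker's own `mom1`/`mom3`/`pairPoly`, cast to `ℝ`);
* **`moment_pairVec`** — EXACTLY the signature of stub S4:
  `Integrable (W·⟪V,V'⟫·e^{−b|y|²}) ∧ ∫ W·⟪V,V'⟫·e^{−b|y|²} = pairVec W V V' b · (π/b)^{3/2}` for `0 < b`.

Width seat ns-wall-eng-6 g0 (prover) for the cert hand's lineage; S1–S3, S5 are theirs.  HONEST FRAMING: calculus of explicit
polynomial × Gaussian integrands — certificate soundness plumbing; nothing here bears on Navier–Stokes regularity (OPEN) or on
crux 23843 (OPEN). [folklore; Gaussian moments]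
-/

noncomputable section

set_option linter.dupNamespace false

namespace Summit.NavierStokesRegularity.NavierStokesRegularity.Cruxes.ScarEnvelopeTypeI.ForcedTsai

open MeasureTheory Set Real Finset
open scoped RealInnerProductSpace
open Literature.Analysis.FluidPDE

/-! ## One-dimensional Gaussian moments -/

/-- The coercion `List ℕ → List ℚ` (monadic lift) is `List.map Nat.cast`. [folklore] -/
theorem coe_list_nat_rat (l : List ℕ) : (↑l : List ℚ) = l.map (fun a : ℕ => (a : ℚ)) := by
  induction l with
  | nil => rfl
  | cons a l ih =>
    change (a :: l : List ℕ) >>= (fun a => pure (a : ℚ)) = _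
    rw [List.bind_eq_flatMap, List.flatMap_cons]
    change [(a : ℚ)] ++ ((l : List ℕ) >>= fun a => pure (a : ℚ)) = _
    rw [show ((l : List ℕ) >>= fun a => pure (a : ℚ)) = (↑l : List ℚ) from rfl, ih]
    rfl

/-- `foldl` of a running product over the cast `range` is the `Finset.range` product. [folklore] -/
theorem foldl_mul_range_eq_prod (k : ℕ) (f : ℚ → ℚ) (a : ℚ) :
    List.foldl (fun acc (i : ℚ) => acc * f i) a (↑(List.range k) : List ℚ) = a * ∏ i ∈ range k, f i := by
  rw [coe_list_nat_rat]
  induction k generalizing a with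
  | zero => simp
  | succ k ih =>
    rw [List.range_succ, List.map_append, List.foldl_append, ih]
    simp [Finset.prod_range_succ, mul_assoc]

/-- The checker's rational `mom1`, cast to `ℝ`: `0` for odd `n`, `∏_{i<n/2} (2i+1)/(2b)` for even `n`. [folklore] -/
theorem mom1_cast (n : ℕ) (b : ℚ) :
    ((mom1 n b : ℚ) : ℝ) = if n % 2 = 1 then 0 else ∏ i ∈ range (n / 2), (2 * (i : ℝ) + 1) / (2 * (b : ℝ)) := by
  unfold mom1
  split_ifs with h
  · simp
  · rw [foldl_mul_range_eq_prod, one_mul]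
    push_cast
    rfl

/-- `Γ(k + ½) = √π · ∏_{i<k} (i + ½)`. [folklore] -/
theorem Gamma_nat_add_half_eq_prod (k : ℕ) :
    Real.Gamma ((k : ℝ) + 1 / 2) = √π * ∏ i ∈ range k, ((i : ℝ) + 1 / 2) := by
  induction k with
  | zero => rw [Nat.cast_zero, zero_add, Finset.prod_range_zero, mul_one, Real.Gamma_one_half_eq]
  | succ k ih =>
    rw [Finset.prod_range_succ, show ((k + 1 : ℕ) : ℝ) + 1 / 2 = ((k : ℝ) + 1 / 2) + 1 by push_cast; ring,
      Real.Gamma_add_one (by positivity), ih]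
    ring

/-- Even moments: `∫ x^{2k} e^{−bx²} = √(π/b) · ∏_{i<k} (2i+1)/(2b)`. [folklore] -/
theorem integral_pow_even_mul_gauss1 (k : ℕ) {b : ℝ} (hb : 0 < b) :
    ∫ x : ℝ, x ^ (2 * k) * Real.exp (-b * x ^ 2) = √(π / b) * ∏ i ∈ range k, (2 * (i : ℝ) + 1) / (2 * b) := by
  have h1 : (fun x : ℝ => x ^ (2 * k) * Real.exp (-b * x ^ 2)) =
      fun x => (fun t : ℝ => t ^ (2 * k) * Real.exp (-b * t ^ 2)) |x| := by
    funext x; simp only [pow_mul, sq_abs]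
  rw [h1, integral_comp_abs (f := fun t : ℝ => t ^ (2 * k) * Real.exp (-b * t ^ 2))]
  have h2 : ∫ x in Set.Ioi (0 : ℝ), x ^ (2 * k) * Real.exp (-b * x ^ 2) =
      ∫ x in Set.Ioi (0 : ℝ), x ^ ((2 * k : ℕ) : ℝ) * Real.exp (-b * x ^ (2 : ℝ)) := by
    refine setIntegral_congr_fun measurableSet_Ioi fun x _ => ?_
    rw [Real.rpow_natCast, Real.rpow_two]
  rw [h2, integral_rpow_mul_exp_neg_mul_rpow two_pos (by have := (2 * k).cast_nonneg (α := ℝ); linarith) hb]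
  rw [show (((2 * k : ℕ) : ℝ) + 1) / 2 = (k : ℝ) + 1 / 2 by push_cast; ring, Gamma_nat_add_half_eq_prod,
    show (-(((2 * k : ℕ) : ℝ) + 1) / 2) = -((k : ℝ) + 1 / 2) by push_cast; ring,
    Real.rpow_neg hb.le, Real.rpow_add hb, Real.rpow_natCast,
    show b ^ (1 / 2 : ℝ) = √b by rw [Real.sqrt_eq_rpow], Real.sqrt_div' _ hb.le]
  have hsb : 0 < √b := Real.sqrt_pos.2 hb
  have hbk : (b : ℝ) ^ k ≠ 0 := pow_ne_zero _ hb.ne'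
  -- ∏ (2i+1)/(2b) = (∏ (i+1/2)) / b^k
  have hprod : ∏ i ∈ range k, (2 * (i : ℝ) + 1) / (2 * b) = (∏ i ∈ range k, ((i : ℝ) + 1 / 2)) / b ^ k := by
    have hterm : ∀ i ∈ range k, (2 * (i : ℝ) + 1) / (2 * b) = ((i : ℝ) + 1 / 2) / b := fun i _ => by
      field_simp
    rw [Finset.prod_congr rfl hterm, Finset.prod_div_distrib, Finset.prod_const, Finset.card_range]
  rw [hprod]
  field_simp

/-- Odd moments vanish: `∫ x^{2k+1} e^{−bx²} = 0`. [folklore] -/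
theorem integral_pow_odd_mul_gauss1 (k : ℕ) (b : ℝ) :
    ∫ x : ℝ, x ^ (2 * k + 1) * Real.exp (-b * x ^ 2) = 0 := by
  have h := integral_neg_eq_self (fun x : ℝ => x ^ (2 * k + 1) * Real.exp (-b * x ^ 2)) volume
  have hodd : Odd (2 * k + 1) := ⟨k, rfl⟩
  have hfun : (fun x : ℝ => (-x) ^ (2 * k + 1) * Real.exp (-b * (-x) ^ 2)) =
      fun x => -(x ^ (2 * k + 1) * Real.exp (-b * x ^ 2)) := by
    funext x; rw [hodd.neg_pow, neg_sq, neg_mul]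
  rw [hfun, integral_neg] at h
  linarith

/-- `x ↦ xⁿ e^{−bx²}` is integrable on `ℝ` (`b > 0`). [folklore] -/
theorem integrable_pow_mul_gauss1 (n : ℕ) {b : ℝ} (hb : 0 < b) :
    Integrable fun x : ℝ => x ^ n * Real.exp (-b * x ^ 2) := by
  have h := integrable_rpow_mul_exp_neg_mul_sq hb (s := n) (by have := n.cast_nonneg (α := ℝ); linarith)
  refine h.congr (Filter.Eventually.of_forall fun x => ?_)
  simp only [Real.rpow_natCast]

/-- **1-D moments**: `∫ xⁿ e^{−bx²} dx = mom1 n b · √(π/b)` for rational `b > 0`. [folklore] -/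
theorem integral_pow_mul_gauss1 (n : ℕ) {b : ℚ} (hb : 0 < b) :
    ∫ x : ℝ, x ^ n * Real.exp (-(b : ℝ) * x ^ 2) = ((mom1 n b : ℚ) : ℝ) * √(π / (b : ℝ)) := by
  have hbR : (0 : ℝ) < (b : ℝ) := by exact_mod_cast hb
  rw [mom1_cast]
  obtain ⟨k, rfl⟩ | ⟨k, rfl⟩ := Nat.even_or_odd n
  · rw [← two_mul, if_neg (by omega), integral_pow_even_mul_gauss1 k hbR,
      show 2 * k / 2 = k by omega, mul_comm]
  · rw [if_pos (by omega), integral_pow_odd_mul_gauss1, zero_mul]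

/-! ## Monomial moments on `ℝ³` -/

/-- The Gaussian factorises over coordinates. [folklore] -/
theorem gauss_eq_prod (b : ℝ) (y : E3) : gauss b y = ∏ j : Fin 3, Real.exp (-b * (y j) ^ 2) := by
  unfold gauss
  rw [EuclideanSpace.real_norm_sq_eq, Finset.mul_sum, ← Real.exp_sum]

/-- A monomial is its coefficient times a coordinate product. [folklore] -/
theorem Mono.eval_eq_prod (m : Mono) (y : E3) : Mono.eval m y = (m.c : ℝ) * ∏ j : Fin 3, (y j) ^ m.exp j := by
  simp [Mono.eval, Fin.prod_univ_three, Mono.exp, mul_assoc]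

/-- The coordinate map `toLp : (Fin 3 → ℝ) → E3` preserves volume (as a measurable equivalence). [folklore] -/
theorem measurePreserving_toLp3 :
    MeasurePreserving (MeasurableEquiv.toLp 2 (Fin 3 → ℝ)) volume volume := by
  simpa using (EuclideanSpace.volume_preserving_symm_measurableEquiv_toLp (Fin 3)).symm

/-- The pulled-back monomial × Gaussian integrand is a coordinate product. [folklore] -/
theorem mono_gauss_toLp (m : Mono) (b : ℝ) (x : Fin 3 → ℝ) :
    Mono.eval m (WithLp.toLp 2 x) * gauss b (WithLp.toLp 2 x) =
      (m.c : ℝ) * ∏ j : Fin 3, ((x j) ^ m.exp j * Real.exp (-b * (x j) ^ 2)) := by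
  rw [Mono.eval_eq_prod, gauss_eq_prod, Finset.prod_mul_distrib]
  simp [mul_assoc]

/-- **Monomial moments**: integrability and `∫ c y^e e^{−b|y|²} = c · mom3 e₁ e₂ e₃ b · (π/b)^{3/2}` (rational `b > 0`). [folklore] -/
theorem integral_mono_gauss (m : Mono) {bq : ℚ} (hbq : 0 < bq) :
    Integrable (fun y : E3 => Mono.eval m y * gauss (bq : ℝ) y) ∧
      ∫ y : E3, Mono.eval m y * gauss (bq : ℝ) y =
        (m.c : ℝ) * ((mom3 m.e1 m.e2 m.e3 bq : ℚ) : ℝ) * (π / (bq : ℝ)) ^ (3 / 2 : ℝ) := by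
  set b : ℝ := (bq : ℝ) with hb_def
  have hb : 0 < b := by rw [hb_def]; exact_mod_cast hbq
  set e := MeasurableEquiv.toLp 2 (Fin 3 → ℝ) with he_def
  have he : MeasurePreserving e volume volume := measurePreserving_toLp3
  set F : E3 → ℝ := fun y => Mono.eval m y * gauss b y with hF
  have hcomp : (F ∘ e) = fun x : Fin 3 → ℝ => (m.c : ℝ) * ∏ j : Fin 3, ((x j) ^ m.exp j * Real.exp (-b * (x j) ^ 2)) := by
    funext x
    simp only [Function.comp_apply, hF]
    exact mono_gauss_toLp m b x
  -- integrability of the coordinate product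
  have hint1 : ∀ j : Fin 3, Integrable (fun t : ℝ => t ^ m.exp j * Real.exp (-b * t ^ 2)) := fun j =>
    integrable_pow_mul_gauss1 _ hb
  have hprodInt : Integrable (fun x : Fin 3 → ℝ => ∏ j : Fin 3, ((x j) ^ m.exp j * Real.exp (-b * (x j) ^ 2))) := by
    have := MeasureTheory.Integrable.fintype_prod (f := fun (j : Fin 3) (t : ℝ) => t ^ m.exp j * Real.exp (-b * t ^ 2)) hint1
    simpa [volume_pi] using this
  have hFe : Integrable (F ∘ e) := by
    rw [hcomp]; exact hprodInt.const_mul _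
  have hFint : Integrable F := (he.integrable_comp_emb e.measurableEmbedding).1 hFe
  refine ⟨hFint, ?_⟩
  -- the value
  have hval : ∫ y : E3, F y = ∫ x : Fin 3 → ℝ, (F ∘ e) x := (he.integral_comp' F).symm
  rw [hval, hcomp, integral_const_mul]
  have hprod : ∫ x : Fin 3 → ℝ, ∏ j : Fin 3, ((x j) ^ m.exp j * Real.exp (-b * (x j) ^ 2)) =
      ∏ j : Fin 3, ∫ t : ℝ, t ^ m.exp j * Real.exp (-b * t ^ 2) := by
    have := MeasureTheory.integral_fintype_prod_eq_prod (𝕜 := ℝ)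
      (fun (j : Fin 3) (t : ℝ) => t ^ m.exp j * Real.exp (-b * t ^ 2)) (μ := fun _ => volume)
    simpa [volume_pi] using this
  rw [hprod, Fin.prod_univ_three, hb_def, integral_pow_mul_gauss1 _ hbq, integral_pow_mul_gauss1 _ hbq,
    integral_pow_mul_gauss1 _ hbq]
  have hpb : 0 ≤ π / (bq : ℝ) := by positivity
  have hs3 : √(π / (bq : ℝ)) ^ 3 = (π / (bq : ℝ)) ^ (3 / 2 : ℝ) := by
    rw [Real.sqrt_eq_rpow, ← Real.rpow_natCast, ← Real.rpow_mul hpb]; norm_num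
  rw [← hs3]
  simp only [Mono.exp, mom3, Rat.cast_mul]
  ring

/-! ## Polynomial moments and the `pairPoly` bookkeeping -/

/-- **Polynomial moments**: `∫ P(y) e^{−b|y|²} dy = (Σ_{m∈P} c_m · mom3 e_m b) · (π/b)^{3/2}`, with integrability. [folklore] -/
theorem integral_qpoly_gauss (P : QPoly) {b : ℚ} (hb : 0 < b) :
    Integrable (fun y : E3 => QPoly.eval P y * gauss (b : ℝ) y) ∧
      ∫ y : E3, QPoly.eval P y * gauss (b : ℝ) y =
        (((P.map fun m => m.c * mom3 m.e1 m.e2 m.e3 b).sum : ℚ) : ℝ) * (π / (b : ℝ)) ^ (3 / 2 : ℝ) := by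
  induction P with
  | nil => simp
  | cons m P ih =>
    obtain ⟨hmi, hmv⟩ := integral_mono_gauss m hb
    obtain ⟨hPi, hPv⟩ := ih
    have hsplit : (fun y : E3 => QPoly.eval (m :: P) y * gauss (b : ℝ) y) =
        fun y => Mono.eval m y * gauss (b : ℝ) y + QPoly.eval P y * gauss (b : ℝ) y := by
      funext y; rw [QPoly.eval_cons]; ring
    rw [hsplit]
    refine ⟨hmi.add hPi, ?_⟩
    rw [integral_add hmi hPi, hmv, hPv, List.map_cons, List.sum_cons]
    push_cast
    ring

/-- `foldl` of a running sum is the sum. [folklore] -/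
theorem foldl_add_eq_add_sum {α : Type*} (g : α → ℚ) (l : List α) (a : ℚ) :
    l.foldl (fun acc x => acc + g x) a = a + (l.map g).sum := by
  induction l generalizing a with
  | nil => simp
  | cons x l ih => simp [List.foldl_cons, ih, add_assoc]

/-- One row of `pairPoly`: `Σ_{m'∈Q} c c' mom3(e+e')` is the moment sum of `Q.map (Mono.mul m)`. [folklore] -/
theorem row_eq_sum_map_mul (m : Mono) (Q : QPoly) (b : ℚ) :
    (Q.map fun m' => m.c * m'.c * mom3 (m.e1 + m'.e1) (m.e2 + m'.e2) (m.e3 + m'.e3) b).sum =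
      ((Q.map (Mono.mul m)).map fun m'' => m''.c * mom3 m''.e1 m''.e2 m''.e3 b).sum := by
  induction Q with
  | nil => simp
  | cons m' Q ih => rw [List.map_cons, List.sum_cons, ih, List.map_cons, List.map_cons, List.sum_cons]; rfl

/-- `pairPoly P Q b` is the moment sum of the product polynomial `mul P Q` (an identity in `ℚ`). [folklore] -/
theorem pairPoly_eq_sum_mul (P Q : QPoly) (b : ℚ) :
    pairPoly P Q b = ((QPoly.mul P Q).map fun m => m.c * mom3 m.e1 m.e2 m.e3 b).sum := by
  unfold pairPoly
  have inner : ∀ (m : Mono) (acc : ℚ),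
      Q.foldl (fun acc' m' => acc' + m.c * m'.c * mom3 (m.e1 + m'.e1) (m.e2 + m'.e2) (m.e3 + m'.e3) b) acc =
        acc + (Q.map fun m' => m.c * m'.c * mom3 (m.e1 + m'.e1) (m.e2 + m'.e2) (m.e3 + m'.e3) b).sum :=
    fun m acc => foldl_add_eq_add_sum _ Q acc
  simp only [inner]
  rw [foldl_add_eq_add_sum, zero_add]
  induction P with
  | nil => simp [QPoly.mul]
  | cons m P ih =>
    rw [List.map_cons, List.sum_cons, ih, row_eq_sum_map_mul,
      show QPoly.mul (m :: P) Q = Q.map (Mono.mul m) ++ QPoly.mul P Q by simp [QPoly.mul], List.map_append,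
      List.sum_append]

/-- The real inner product of two symbolic vector fields is the sum of the coordinate products. [folklore] -/
theorem inner_evalVec (V V' : Fin 3 → QPoly) (y : E3) :
    ⟪evalVec V y, evalVec V' y⟫ = ∑ i : Fin 3, QPoly.eval (V i) y * QPoly.eval (V' i) y := by
  simp [evalVec, PiLp.inner_apply, mul_comm]

/-- The integrand of S4 is a single sparse polynomial times the Gaussian. [folklore] -/
theorem integrand_eq_eval (W : QPoly) (V V' : Fin 3 → QPoly) (b : ℝ) (y : E3) :
    QPoly.eval W y * ⟪evalVec V y, evalVec V' y⟫ * gauss b y =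
      QPoly.eval (QPoly.add (QPoly.add (QPoly.mul (QPoly.nmul W (V 0)) (V' 0)) (QPoly.mul (QPoly.nmul W (V 1)) (V' 1)))
        (QPoly.mul (QPoly.nmul W (V 2)) (V' 2))) y * gauss b y := by
  rw [inner_evalVec, Fin.sum_univ_three]
  simp only [QPoly.eval_add, QPoly.eval_mul, QPoly.eval_nmul]
  ring

/-- **Stub S4 (`stub_moment_pairVec`) — the `ℝ³` Gaussian-moment identity behind `pairVec`, with integrability.**
For every weight polynomial `W`, symbolic vector fields `V, V'` and rational rate `b > 0`:
`y ↦ W(y)·⟪V(y),V'(y)⟫·e^{−b|y|²}` is integrable on `ℝ³` and its integral equals `pairVec W V V' b · (π/b)^{3/2}`.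
[folklore; Gaussian moments] -/
theorem moment_pairVec (W : QPoly) (V V' : Fin 3 → QPoly) {b : ℚ} (hb : 0 < b) :
    Integrable (fun y : E3 => QPoly.eval W y * ⟪evalVec V y, evalVec V' y⟫ * gauss (b : ℝ) y) ∧
      ∫ y : E3, QPoly.eval W y * ⟪evalVec V y, evalVec V' y⟫ * gauss (b : ℝ) y =
        (pairVec W V V' b : ℝ) * (Real.pi / (b : ℝ)) ^ (3 / 2 : ℝ) := by
  set Q : QPoly := QPoly.add (QPoly.add (QPoly.mul (QPoly.nmul W (V 0)) (V' 0)) (QPoly.mul (QPoly.nmul W (V 1)) (V' 1)))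
    (QPoly.mul (QPoly.nmul W (V 2)) (V' 2)) with hQ
  have hfun : (fun y : E3 => QPoly.eval W y * ⟪evalVec V y, evalVec V' y⟫ * gauss (b : ℝ) y) =
      fun y => QPoly.eval Q y * gauss (b : ℝ) y := by
    funext y; rw [integrand_eq_eval]
  obtain ⟨hint, hval⟩ := integral_qpoly_gauss Q hb
  rw [hfun]
  refine ⟨hint, ?_⟩
  rw [hval]
  congr 1
  -- the ℚ-identity: moment sum of Q = pairVec W V V' b
  rw [hQ, QPoly.add, QPoly.add, List.map_append, List.map_append, List.sum_append, List.sum_append]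
  unfold pairVec
  rw [pairPoly_eq_sum_mul, pairPoly_eq_sum_mul, pairPoly_eq_sum_mul]

/-- Signature check: `moment_pairVec` has EXACTLY the type of the skeleton's stub S4 `stub_moment_pairVec`. -/
example (W : QPoly) (V V' : Fin 3 → QPoly) {b : ℚ} (hb : 0 < b) :
    Integrable (fun y : E3 => QPoly.eval W y * ⟪evalVec V y, evalVec V' y⟫ * gauss (b : ℝ) y) ∧
      ∫ y : E3, QPoly.eval W y * ⟪evalVec V y, evalVec V' y⟫ * gauss (b : ℝ) y =
        (pairVec W V V' b : ℝ) * (Real.pi / (b : ℝ)) ^ (3 / 2 : ℝ) :=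
  moment_pairVec W V V' hb

end Summit.NavierStokesRegularity.NavierStokesRegularity.Cruxes.ScarEnvelopeTypeI.ForcedTsai
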